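import Summits.QuantumFields.YangMills.Theorems.AllWindowsColdBoxDirFreeVarThomson
import HarnessLib

/-!
# Stub C `DirFreeVarLinear` (stmt-QuantumFields-24003) — part 2a: the Pólya octant flow (definition, conservation, support)

Stub C of LINE-17 (`DirFreeVarLinear`, crux `AllWindowsColdBox.BoxMidWindowsSU22`, stmt-QuantumFields-24003) — part 2a:
the 2-chain of a bottom temporal («Polyakov») free edge `e = ((0, z⃗₀), e₀)` of the cold-wall box.

Thomson's principle (part 1, `…DirFreeVarThomson`) bounds `(Q_D⁻¹)_{ee}` by the `ℓ²`-norm of ANY 2-chain whose free boundary is `δ_e`.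
For a temporal 2-chain `ψ(x, 0, k) = w x k` the boundary conditions read (part 1, `chainCoeff_temporal`): `w` constant in time on every
free spatial edge, and spatial divergence `= δ` on the free temporal edges.  Hence the chain is a TIME-CONSTANT copy (`x₀ ∈ [−1, 2H]`) of a
unit flow `J` on the spatial box `{0,…,2H}³` from `z⃗₀` to the cold wall, and `‖ψ‖² = (2H+2)·Σ J²`: the linear rate of the stub is the
transience of `ℤ³` (a point-to-boundary unit flow of bounded energy).  We use the explicit 3-colour PÓLYA-URN OCTANT FLOW
`J(z⃗₀ + (a,b,c) → + e_k) = 2/((n+1)(n+2)) · (a_k + 1)/(n + 3)`, `n = a + b + c` (vertex flux uniform on each simplex `a+b+c = n`):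
* `octN`, `octW` — the weights (definitions of real functions, no `Prop`);
* `octW_zero`, `octW_sub_e0` — time-constancy; `octW_div` — conservation: divergence `1` on the source column, `0` elsewhere in the box;
* `shift_mem_index`, `octW_support` — the chain lives on plaquettes of the enlarged box `{−1,…,2H+1}⁴`;
* `sum_index_le_sum_param` — a generic support-reindexing bound for sums over the index set of `Q_D`.
The energy bound is part 2b (`…DirFreeVarOctantEnergy`).

HONEST LABEL: helpers for ONE registered stub (C `DirFreeVarLinear`) of two critic-PASSed lines on the R2ξ″ RECORD-rung cruxes
24003/24006; no crux, rung or summit is proved; the Yang–Mills mass gap is NOT proved by this file.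
-/

set_option autoImplicit false

noncomputable section

open MeasureTheory Matrix Finset
open Literature.MathematicalPhysics.QuantumFieldTheory
open Literature.MathematicalPhysics.QuantumFieldTheory.LatticeMaxwell
open Literature.MathematicalPhysics.QuantumFieldTheory.AxialGauge
open Literature.Probability.LatticeModels (Site halfOpenBox mem_halfOpenBox)
open Summit.QuantumFields.YangMills.Theorems.WeakCouplingRates

namespace Summit.QuantumFields.YangMills.Theorems.AllWindowsColdBoxDirFreeVar

/-! ## 5. The Pólya-urn octant flow (the 2-chain of a bottom temporal «Polyakov» edge) -/

section Flow

variable {H : ℕ}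

/-- The «generation» of a spatial point `x` seen from the source `z₀`: `n(x) = Σ_{j ≠ 0} (x_j − z₀,j)` (as a real number). -/
def octN (z₀ x : Site 4) : ℝ := ∑ j ∈ (Finset.univ : Finset (Fin 4)).erase 0, ((x j - z₀ j : ℤ) : ℝ)

/-- **The octant flow weights.**  On the temporal plaquette `(x, 0, k)` (`k ≠ 0`) with `−1 ≤ x₀ ≤ 2H` and `x` in the spatial
octant-box `z₀,j ≤ x_j ≤ 2H` (`j ≠ 0`): the 3-colour Pólya-urn transition weight
`2/((n+1)(n+2)) · (x_k − z₀,k + 1)/(n + 3)`, `n = n(x)`; zero elsewhere.  Time-constant by design. -/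
def octW (H : ℕ) (z₀ x : Site 4) (k : Fin 4) : ℝ :=
  if k ≠ 0 ∧ (-1 ≤ x 0 ∧ x 0 ≤ 2 * (H : ℤ)) ∧ (∀ j : Fin 4, j ≠ 0 → z₀ j ≤ x j ∧ x j ≤ 2 * (H : ℤ)) then
    2 / ((octN z₀ x + 1) * (octN z₀ x + 2)) * (((x k - z₀ k : ℤ) : ℝ) + 1) / (octN z₀ x + 3)
  else 0

/-- `octW` vanishes in the time direction. -/
theorem octW_zero (z₀ x : Site 4) : octW H z₀ x 0 = 0 := by
  simp [octW]

/-- `octW` is time-constant: `w (z − e₀) i = w z i` for `0 ≤ z₀ ≤ 2H`. -/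
theorem octW_sub_e0 (z₀ z : Site 4) (hz : 0 ≤ z 0 ∧ z 0 ≤ 2 * (H : ℤ)) (i : Fin 4) :
    octW H z₀ (z - Pi.single 0 1) i = octW H z₀ z i := by
  have hsp : ∀ j : Fin 4, j ≠ 0 → (z - Pi.single 0 1 : Site 4) j = z j := fun j hj => by
    simp [Pi.sub_apply, hj]
  have h0 : (z - Pi.single 0 1 : Site 4) 0 = z 0 - 1 := by simp
  have hN : octN z₀ (z - Pi.single 0 1) = octN z₀ z := by
    unfold octN
    refine Finset.sum_congr rfl fun j hj => ?_
    rw [hsp j (Finset.ne_of_mem_erase hj)]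
  unfold octW
  by_cases hi : i = 0
  · simp [hi]
  · have hcond : ((-1 ≤ (z - Pi.single 0 1 : Site 4) 0 ∧ (z - Pi.single 0 1 : Site 4) 0 ≤ 2 * (H : ℤ)) ∧
        (∀ j : Fin 4, j ≠ 0 → z₀ j ≤ (z - Pi.single 0 1 : Site 4) j ∧ (z - Pi.single 0 1 : Site 4) j ≤ 2 * (H : ℤ))) ↔
        ((-1 ≤ z 0 ∧ z 0 ≤ 2 * (H : ℤ)) ∧ (∀ j : Fin 4, j ≠ 0 → z₀ j ≤ z j ∧ z j ≤ 2 * (H : ℤ))) := by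
      rw [h0]
      constructor
      · rintro ⟨h1, h2⟩
        exact ⟨⟨by omega, hz.2⟩, fun j hj => by have := h2 j hj; rwa [hsp j hj] at this⟩
      · rintro ⟨h1, h2⟩
        exact ⟨⟨by omega, by omega⟩, fun j hj => by rw [hsp j hj]; exact h2 j hj⟩
    rw [hN, hsp i hi]
    simp only [ne_eq, hi, not_false_eq_true, true_and]
    rw [if_congr hcond rfl rfl]

/-- **Flow conservation**: on a spatial box point `z` at an admissible time, the divergence of the octant flow is `1` at the
source column `z⃗ = z⃗₀` and `0` elsewhere. -/
theorem octW_div (z₀ z : Site 4) (ht : -1 ≤ z 0 ∧ z 0 ≤ 2 * (H : ℤ))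
    (hz : ∀ j : Fin 4, j ≠ 0 → 0 ≤ z j ∧ z j ≤ 2 * (H : ℤ)) :
    ∑ k : Fin 4, (octW H z₀ z k - octW H z₀ (z - Pi.single k 1) k) =
      if (∀ j : Fin 4, j ≠ 0 → z j = z₀ j) then 1 else 0 := by
  classical
  -- the time-direction term vanishes
  rw [Fin.sum_univ_succ, octW_zero]
  have hsub0 : octW H z₀ (z - Pi.single 0 1) 0 = 0 := octW_zero _ _
  rw [hsub0, sub_zero, zero_add]
  by_cases hA : ∀ j : Fin 4, j ≠ 0 → z₀ j ≤ z j ∧ z j ≤ 2 * (H : ℤ)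
  · -- inside the octant: out = θ(n), in = θ(n-1)·n/(n+2)
    set n : ℝ := octN z₀ z with hn
    have ha : ∀ j : Fin 4, j ≠ 0 → (0 : ℝ) ≤ ((z j - z₀ j : ℤ) : ℝ) := fun j hj => by
      have := (hA j hj).1; exact_mod_cast (by omega : (0 : ℤ) ≤ z j - z₀ j)
    have hn0 : 0 ≤ n := Finset.sum_nonneg fun j hj => ha j (Finset.ne_of_mem_erase hj)
    -- out-weights
    have hout : ∀ k : Fin 4, k ≠ 0 → octW H z₀ z k =
        2 / ((n + 1) * (n + 2)) * (((z k - z₀ k : ℤ) : ℝ) + 1) / (n + 3) := fun k hk => by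
      unfold octW; rw [if_pos ⟨hk, ht, hA⟩]
    -- in-weights
    have hin : ∀ k : Fin 4, k ≠ 0 → octW H z₀ (z - Pi.single k 1) k =
        2 / (n * (n + 1)) * ((z k - z₀ k : ℤ) : ℝ) / (n + 2) := fun k hk => by
      have hk' : (z - Pi.single k 1 : Site 4) k = z k - 1 := by simp
      have hj' : ∀ j : Fin 4, j ≠ k → (z - Pi.single k 1 : Site 4) j = z j := fun j hj => by
        simp [Pi.sub_apply, hj]
      by_cases hak : z₀ k + 1 ≤ z k
      · -- predecessor in the octant, generation n - 1
        have hN : octN z₀ (z - Pi.single k 1) = n - 1 := by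
          rw [hn]; unfold octN
          rw [← Finset.add_sum_erase _ _ (Finset.mem_erase.2 ⟨hk, Finset.mem_univ k⟩),
            ← Finset.add_sum_erase ((Finset.univ : Finset (Fin 4)).erase 0) _ (Finset.mem_erase.2 ⟨hk, Finset.mem_univ k⟩)]
          rw [hk', Finset.sum_congr rfl fun j hj => by rw [hj' j (Finset.ne_of_mem_erase hj)]]
          push_cast; ring
        have hcond : (k ≠ 0 ∧ (-1 ≤ (z - Pi.single k 1 : Site 4) 0 ∧ (z - Pi.single k 1 : Site 4) 0 ≤ 2 * (H : ℤ)) ∧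
            (∀ j : Fin 4, j ≠ 0 → z₀ j ≤ (z - Pi.single k 1 : Site 4) j ∧ (z - Pi.single k 1 : Site 4) j ≤ 2 * (H : ℤ))) := by
          refine ⟨hk, ?_, fun j hj => ?_⟩
          · rw [hj' 0 (Ne.symm hk)]; exact ht
          · by_cases hjk : j = k
            · subst hjk; rw [hk']; have := hA j hj; constructor <;> omega
            · rw [hj' j hjk]; exact hA j hj
        unfold octW; rw [if_pos hcond, hN, hk']
        push_cast; ring
      · -- no predecessor: the weight vanishes and so does `z_k - z₀_k`
        have hzk : z k = z₀ k := by have := (hA k hk).1; omega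
        have hcond : ¬ (k ≠ 0 ∧ (-1 ≤ (z - Pi.single k 1 : Site 4) 0 ∧ (z - Pi.single k 1 : Site 4) 0 ≤ 2 * (H : ℤ)) ∧
            (∀ j : Fin 4, j ≠ 0 → z₀ j ≤ (z - Pi.single k 1 : Site 4) j ∧ (z - Pi.single k 1 : Site 4) j ≤ 2 * (H : ℤ))) := by
          rintro ⟨-, -, h3⟩
          have := (h3 k hk).1; rw [hk'] at this; omega
        unfold octW; rw [if_neg hcond, hzk]; simp
    -- the three spatial terms
    simp only [Fin.sum_univ_three, Fin.succ_zero_eq_one, Fin.succ_one_eq_two, show (2 : Fin 3).succ = (3 : Fin 4) from rfl]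
    have h1 := hout 1 (by decide); have h2 := hout 2 (by decide); have h3 := hout 3 (by decide)
    have i1 := hin 1 (by decide); have i2 := hin 2 (by decide); have i3 := hin 3 (by decide)
    rw [h1, h2, h3, i1, i2, i3]
    -- `n = a₁ + a₂ + a₃`
    have hn3 : n = ((z 1 - z₀ 1 : ℤ) : ℝ) + ((z 2 - z₀ 2 : ℤ) : ℝ) + ((z 3 - z₀ 3 : ℤ) : ℝ) := by
      rw [hn]; unfold octN
      have : ((Finset.univ : Finset (Fin 4)).erase 0) = {1, 2, 3} := by decide
      rw [this, Finset.sum_insert (by decide), Finset.sum_insert (by decide), Finset.sum_singleton]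
      ring
    have ha1 := ha 1 (by decide); have ha2 := ha 2 (by decide); have ha3 := ha 3 (by decide)
    by_cases hsrc : ∀ j : Fin 4, j ≠ 0 → z j = z₀ j
    · rw [if_pos hsrc]
      have e1 : ((z 1 - z₀ 1 : ℤ) : ℝ) = 0 := by rw [hsrc 1 (by decide)]; simp
      have e2 : ((z 2 - z₀ 2 : ℤ) : ℝ) = 0 := by rw [hsrc 2 (by decide)]; simp
      have e3 : ((z 3 - z₀ 3 : ℤ) : ℝ) = 0 := by rw [hsrc 3 (by decide)]; simp
      rw [hn3, e1, e2, e3]; norm_num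
    · rw [if_neg hsrc]
      -- `n > 0`
      have hnpos : 0 < n := by
        rw [hn3]
        by_contra hle
        push Not at hle
        apply hsrc
        intro j hj
        have e1 : (z 1 - z₀ 1 : ℤ) = 0 := by exact_mod_cast (show ((z 1 - z₀ 1 : ℤ) : ℝ) = 0 by linarith)
        have e2 : (z 2 - z₀ 2 : ℤ) = 0 := by exact_mod_cast (show ((z 2 - z₀ 2 : ℤ) : ℝ) = 0 by linarith)
        have e3 : (z 3 - z₀ 3 : ℤ) = 0 := by exact_mod_cast (show ((z 3 - z₀ 3 : ℤ) : ℝ) = 0 by linarith)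
        have hj' : j = 1 ∨ j = 2 ∨ j = 3 := by
          fin_cases j
          · exact absurd rfl hj
          · exact Or.inl rfl
          · exact Or.inr (Or.inl rfl)
          · exact Or.inr (Or.inr rfl)
        rcases hj' with rfl | rfl | rfl <;> omega
      rw [hn3] at hnpos ⊢
      field_simp
      ring
  · -- outside the octant: every weight vanishes, and `z⃗ ≠ z⃗₀`
    have hout : ∀ k : Fin 4, octW H z₀ z k = 0 := fun k => by
      unfold octW; rw [if_neg]; rintro ⟨-, -, h⟩; exact hA h
    have hin : ∀ k : Fin 4, k ≠ 0 → octW H z₀ (z - Pi.single k 1) k = 0 := fun k hk => by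
      unfold octW; rw [if_neg]
      rintro ⟨-, -, h⟩
      apply hA
      intro j hj
      have := h j hj
      by_cases hjk : j = k
      · subst hjk; simp at this; constructor <;> [omega; exact (hz j hj).2]
      · have e : (z - Pi.single k 1 : Site 4) j = z j := by simp [Pi.sub_apply, hjk]
        rw [e] at this; exact this
    have hne : ¬ (∀ j : Fin 4, j ≠ 0 → z j = z₀ j) := by
      intro h; apply hA; intro j hj; rw [h j hj]; exact ⟨le_rfl, by rw [← h j hj]; exact (hz j hj).2⟩
    rw [if_neg hne]
    refine Finset.sum_eq_zero fun k _ => ?_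
    rw [hout, hin _ (Fin.succ_ne_zero k), sub_zero]


/-! ### Index-set membership and a generic support-reindexing bound -/

/-- A plaquette `(x, i, j)` (`i < j`) all of whose corners lie in the enlarged box `{−1,…,2H+1}⁴` belongs to the (shifted) index set
of `Q_D`. -/
theorem shift_mem_index {x : Site 4} {i j : Fin 4} (hij : i < j)
    (hx : ∀ l : Fin 4, -1 ≤ x l ∧ x l + (if l = i then 1 else 0) + (if l = j then 1 else 0) ≤ 2 * (H : ℤ) + 1) :
    Plaq.shift (-dirCorner) (x, i, j) ∈ plaquettesIn (halfOpenBox 4 (2 * H + 3)) := by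
  rw [Plaq.mem_plaquettesIn]
  simp only [Plaq.shift, mem_halfOpenBox, Pi.add_apply, Pi.neg_apply, dirCorner, Pi.single_apply]
  refine ⟨fun l => ?_, hij, fun l => ?_, fun l => ?_, fun l => ?_⟩ <;>
  · have h := hx l
    split_ifs at h ⊢ <;> push_cast <;> omega

/-- The octant flow is supported on plaquettes of the enlarged box (for a source with nonnegative spatial coordinates). -/
theorem octW_support (z₀ : Site 4) (hz₀ : ∀ j : Fin 4, j ≠ 0 → 0 ≤ z₀ j) (x : Site 4) (k : Fin 4)
    (h : octW H z₀ x k ≠ 0) : Plaq.shift (-dirCorner) (x, 0, k) ∈ plaquettesIn (halfOpenBox 4 (2 * H + 3)) := by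
  unfold octW at h
  split_ifs at h with hc
  · obtain ⟨hk, ht, hsp⟩ := hc
    refine shift_mem_index (Fin.pos_iff_ne_zero.2 hk) fun l => ?_
    by_cases hl : l = 0
    · subst hl; simp [hk.symm]; omega
    · have := hsp l hl; have := hz₀ l hl
      simp only [hl, if_false, add_zero]
      split_ifs <;> omega
  · exact absurd rfl h

/-- **Support reindexing.**  If a nonnegative `f` on plaquettes vanishes off the image `ι(U)` of a finite parameter set on which `ι`
is injective, then its sum over the index set of `Q_D` is at most `Σ_{u ∈ U} f (ι u)`. -/
theorem sum_index_le_sum_param {β : Type*} [DecidableEq β] (U : Finset β) (ι : β → Plaq 4) (hι : Set.InjOn ι U)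
    (f : Plaq 4 → ℝ) (hf : ∀ q, 0 ≤ f q) (hsupp : ∀ q, f q ≠ 0 → ∃ u ∈ U, ι u = q) :
    ∑ p ∈ plaquettesIn (halfOpenBox 4 (2 * H + 3)), f (Plaq.shift dirCorner p) ≤ ∑ u ∈ U, f (ι u) := by
  classical
  set P := plaquettesIn (halfOpenBox 4 (2 * H + 3)) with hP
  set U' := U.filter (fun u => Plaq.shift (-dirCorner) (ι u) ∈ P) with hU'
  have hinj' : Set.InjOn (fun u => Plaq.shift (-dirCorner) (ι u)) U' := by
    intro u hu u' hu' huu'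
    have h1 : ι u = ι u' := by
      have := congrArg (Plaq.shift dirCorner) huu'
      simpa only [shift_shift_neg] using this
    exact hι (Finset.mem_of_mem_filter _ hu) (Finset.mem_of_mem_filter _ hu') h1
  have hsub : U'.image (fun u => Plaq.shift (-dirCorner) (ι u)) ⊆ P := by
    intro p hp
    obtain ⟨u, hu, rfl⟩ := Finset.mem_image.1 hp
    exact (Finset.mem_filter.1 hu).2
  calc ∑ p ∈ P, f (Plaq.shift dirCorner p)
      = ∑ p ∈ U'.image (fun u => Plaq.shift (-dirCorner) (ι u)), f (Plaq.shift dirCorner p) := by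
        symm
        refine Finset.sum_subset hsub fun p hp hpn => ?_
        by_contra hne
        obtain ⟨u, hu, hq⟩ := hsupp _ hne
        apply hpn
        refine Finset.mem_image.2 ⟨u, Finset.mem_filter.2 ⟨hu, ?_⟩, ?_⟩
        · rw [hq, shift_neg_shift]; exact hp
        · rw [hq, shift_neg_shift]
    _ = ∑ u ∈ U', f (Plaq.shift dirCorner (Plaq.shift (-dirCorner) (ι u))) := Finset.sum_image hinj'
    _ = ∑ u ∈ U', f (ι u) := Finset.sum_congr rfl fun u _ => by rw [shift_shift_neg]
    _ ≤ ∑ u ∈ U, f (ι u) := Finset.sum_le_sum_of_subset_of_nonneg (Finset.filter_subset _ _) fun u _ _ => hf _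

end Flow

end Summit.QuantumFields.YangMills.Theorems.AllWindowsColdBoxDirFreeVar

end
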